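import Summits.ABC.StewartYu.PadicW80ParB
import HarnessLib

/-!
# The `p`-adic Waldschmidt parameter record — part C (sequel of `PadicW80ParB`)

Support file (plain definitions and theorems; no named facts): continuation of the twin of
`Waldschmidt1980Params/ParamsB/Sizes/Numeric/Main` on the record `PadicW80Par`
(design, HOME/p1/WP-A4-table.md: `V_max` inside the logarithms `W⋆, G` and an ARBITRARY eliminated size
`1 ≤ V_el ≤ V_max` in `U` — p2's FLAG F-p2-3; `c_S = 2¹⁵` — the `p`-adic zeros-per-`𝔘` ratio; all names carry a
suffix `p` to keep them apart from the archimedean record `W80Par`). [cite: Waldschmidt1980, §3.2–3.5 (pp. 264–274)]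
-/

noncomputable section

open Finset Real
open Literature.NumberTheory.Transcendental Literature.NumberTheory.Transcendental.Waldschmidt1980

namespace Summit.ABC.StewartYu

namespace PadicW80Par

variable {d : ℕ} (P : PadicW80Par d)

/-- **`log U ≤ 10 W⋆`**: `U = Aᵐ m^{2m+1}/m! (∏V)V_θ W⋆ G` and each factor is `exp(O(W⋆))`
(`m log Ap ≤ 4W⋆`, `(2m+1) log m ≤ W⋆`, `∑ log Vⱼ + log V_θ ≤ W⋆`, `log W⋆ ≤ W⋆`, `log G ≤ 2W⋆`).
[folklore] -/
theorem log_U_le : Real.log P.Up ≤ 10 * P.Wstarp := by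
  have hW := P.one_le_Wstar; have hm := two_le_mR P; have hm0 := mR_pos P
  have hG := P.one_le_G; have hGW := P.G_le_two_Wstar
  have hVθ := P.one_le_Vθ; have hV := P.one_le_prodV; have hVm := P.one_le_Vmax
  have h9 := P.nine_mR_le_Wstar
  have hml := P.mlog_le_Wstar
  -- `U ≤ exp(10 W⋆)` multiplicatively
  apply (Real.log_le_iff_le_exp P.U_pos).mpr
  -- factor bounds
  have f1 : Ap ^ (d + 1) ≤ Real.exp (4 * P.Wstarp) := by
    -- `Ap^m = 2^{50 m} ≤ e^{35 m} ≤ e^{4 W⋆}` since `9m ≤ W⋆`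
    unfold Ap
    have h2 : (2 : ℝ) ^ 50 ≤ Real.exp 35 := by
      have := Real.exp_one_gt_d9
      have h3 : (2.7182818283 : ℝ) ^ 35 ≤ Real.exp 1 ^ 35 := by gcongr
      rw [← Real.exp_nat_mul] at h3
      norm_num at h3 ⊢
      linarith
    calc ((2 : ℝ) ^ 50) ^ (d + 1) ≤ (Real.exp 35) ^ (d + 1) := by gcongr
      _ = Real.exp (35 * mRp d) := by rw [← Real.exp_nat_mul]; unfold mRp; push_cast; ring_nf
      _ ≤ Real.exp (4 * P.Wstarp) := Real.exp_le_exp.mpr (by nlinarith)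
  have f2 : mRp d ^ (2 * d + 3) / (d + 1).factorial ≤ Real.exp (P.Wstarp) := by
    -- `m^{2m+1}/m! ≤ m^{m+1} e^{m}` (`m^m ≤ e^m m!`) and `(m+1) log m + m ≤ m (9 + log m) ≤ W⋆`
    have hfacpos : (0 : ℝ) < (d + 1).factorial := by exact_mod_cast Nat.factorial_pos _
    have hst := CW77.pow_self_le_exp_mul_factorial (d + 1)
    have em : ((d + 1 : ℕ) : ℝ) = mRp d := by unfold mRp; push_cast; ring
    rw [em] at hst
    have hlogm : 0 ≤ Real.log (mRp d) := Real.log_nonneg (by linarith)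
    have hlog13 : Real.log (2 ^ 13 * mRp d * P.Vmax) = Real.log (2 ^ 13 * P.Vmax) + Real.log (mRp d) := by
      rw [show (2 : ℝ) ^ 13 * mRp d * P.Vmax = (2 ^ 13 * P.Vmax) * mRp d by ring, Real.log_mul (by positivity) hm0.ne']
    have h13 : 9 ≤ Real.log (2 ^ 13 * P.Vmax) := by
      have e9 : Real.exp 9 ≤ 2 ^ 13 * P.Vmax := by
        have := Real.exp_one_lt_d9
        calc Real.exp 9 = Real.exp 1 ^ 9 := by rw [← Real.exp_nat_mul]; norm_num
          _ ≤ (2.7182818286 : ℝ) ^ 9 := by gcongr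
          _ ≤ 2 ^ 13 * 1 := by norm_num
          _ ≤ 2 ^ 13 * P.Vmax := by gcongr
      calc (9 : ℝ) = Real.log (Real.exp 9) := (Real.log_exp 9).symm
        _ ≤ _ := Real.log_le_log (Real.exp_pos _) e9
    -- `m^{2d+3}/(d+1)! ≤ m^{d+2} e^{d+1}`
    have h1 : mRp d ^ (2 * d + 3) / (d + 1).factorial ≤ mRp d ^ (d + 2) * Real.exp 1 ^ (d + 1) := by
      rw [div_le_iff₀ hfacpos]
      calc mRp d ^ (2 * d + 3) = mRp d ^ (d + 2) * mRp d ^ (d + 1) := by rw [← pow_add]; ring_nf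
        _ ≤ mRp d ^ (d + 2) * (Real.exp 1 ^ (d + 1) * (d + 1).factorial) :=
            mul_le_mul_of_nonneg_left hst (by positivity)
        _ = mRp d ^ (d + 2) * Real.exp 1 ^ (d + 1) * (d + 1).factorial := by ring
    refine h1.trans ?_
    have e1 : mRp d ^ (d + 2) * Real.exp 1 ^ (d + 1) = Real.exp ((d + 2 : ℕ) * Real.log (mRp d) + (d + 1 : ℕ)) := by
      rw [Real.exp_add, Real.exp_nat_mul, Real.exp_log hm0, ← Real.exp_nat_mul, mul_one]
    rw [e1]
    apply Real.exp_le_exp.mpr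
    have e2 : ((d + 2 : ℕ) : ℝ) = mRp d + 1 := by unfold mRp; push_cast; ring
    have e3 : ((d + 1 : ℕ) : ℝ) = mRp d := em
    rw [e2, e3]
    have hlogm' : Real.log (mRp d) ≤ mRp d := (Real.log_le_sub_one_of_pos hm0).trans (by linarith)
    calc (mRp d + 1) * Real.log (mRp d) + mRp d ≤ mRp d * (9 + Real.log (mRp d)) := by nlinarith
      _ ≤ mRp d * Real.log (2 ^ 13 * mRp d * P.Vmax) := by
          rw [hlog13]; exact mul_le_mul_of_nonneg_left (by linarith) hm0.le
      _ ≤ P.Wstarp := hml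
  have f3 : (∏ j, P.Vs j) * P.Vel ≤ Real.exp P.Wstarp := by
    -- `Vⱼ, V_θ ≤ V_max`, so the product is `≤ Vmax^{d+1} = exp((d+1) log Vmax) ≤ exp(m log(2^13 m Vmax)) ≤ exp W⋆`
    have hVle : ∀ j, P.Vs j ≤ P.Vmax := fun j => P.hVmax j
    have h1 : (∏ j, P.Vs j) ≤ P.Vmax ^ d := by
      calc (∏ j, P.Vs j) ≤ ∏ _j : Fin d, P.Vmax := prod_le_prod (fun j _ => le_trans zero_le_one (P.hV j)) fun j _ => hVle j
        _ = P.Vmax ^ d := by rw [prod_const, card_univ, Fintype.card_fin]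
    have hVm1 := P.hVmax1
    have hVθ0 : 0 < P.Vmax := by linarith
    calc (∏ j, P.Vs j) * P.Vel ≤ P.Vmax ^ d * P.Vmax :=
          mul_le_mul h1 P.hVθmax (by linarith [P.hVθ1]) (by positivity)
      _ = P.Vmax ^ (d + 1) := by rw [pow_succ]
      _ = Real.exp ((d + 1 : ℕ) * Real.log P.Vmax) := by rw [Real.exp_nat_mul, Real.exp_log hVθ0]
      _ ≤ Real.exp P.Wstarp := by
          apply Real.exp_le_exp.mpr
          have e : ((d + 1 : ℕ) : ℝ) = mRp d := by unfold mRp; push_cast; ring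
          rw [e]
          have hlv : Real.log P.Vmax ≤ Real.log (2 ^ 13 * mRp d * P.Vmax) := by
            apply Real.log_le_log hVθ0
            have : (1 : ℝ) ≤ 2 ^ 13 * mRp d := by nlinarith
            nlinarith
          have hlv0 : 0 ≤ Real.log P.Vmax := Real.log_nonneg hVm1
          calc mRp d * Real.log P.Vmax ≤ mRp d * Real.log (2 ^ 13 * mRp d * P.Vmax) := mul_le_mul_of_nonneg_left hlv hm0.le
            _ ≤ P.Wstarp := hml
  have f4 : P.Wstarp ≤ Real.exp P.Wstarp := by linarith [Real.add_one_le_exp P.Wstarp]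
  have f5 : P.Gp ≤ Real.exp (2 * P.Wstarp) := by linarith [Real.add_one_le_exp (2 * P.Wstarp)]
  unfold Up
  calc Ap ^ (d + 1) * (mRp d ^ (2 * d + 3) / (d + 1).factorial) * ((∏ j, P.Vs j) * P.Vel) * P.Wstarp * P.Gp
      ≤ Real.exp (4 * P.Wstarp) * Real.exp P.Wstarp * Real.exp P.Wstarp * Real.exp P.Wstarp * Real.exp (2 * P.Wstarp) := by
        have := P.U_pos
        have h0 : 0 ≤ mRp d ^ (2 * d + 3) / (d + 1).factorial := by positivity
        have h00 : 0 ≤ (∏ j, P.Vs j) * P.Vel := by positivity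
        gcongr
    _ = Real.exp (9 * P.Wstarp) := by simp only [← Real.exp_add]; ring_nf
    _ ≤ Real.exp (10 * P.Wstarp) := Real.exp_le_exp.mpr (by linarith)

/-- `log T ≤ 10 W⋆` (`T ≤ U`). [folklore] -/
theorem log_T_le : Real.log P.Tp ≤ 10 * P.Wstarp := by
  have hT : (P.Tp : ℝ) ≤ P.Up := by
    have h := P.T_le; have hW := P.one_le_Wstar; have hU := P.U_pos
    refine h.trans (div_le_self hU.le ?_)
    unfold cTp
    have : (1 : ℝ) ≤ 2 ^ (d + 1) := one_le_pow₀ (by norm_num)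
    nlinarith
  exact (Real.log_le_log P.T_pos hT).trans P.log_U_le

/-! ### The height exponents: `S₀ (∑ LⱼVⱼ + L_θ V_θ) ≤ 𝔘/(2 c_L')` -/

/-- `S₀ Lⱼ Vⱼ ≤ 𝔘/(2 c_L' m)`. [folklore] -/
theorem S₀LV_le_one (j : Fin d) : (P.S₀p : ℝ) * (P.Lp j * P.Vs j) ≤ P.𝔘p / (2 * cLp' * mRp d) := by
  have hL : (P.Lp j : ℝ) ≤ P.Up / (cLp' * mRp d * 2 ^ (d + 2) * P.S₀p * P.Vs j) := by
    unfold Lp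
    exact Nat.floor_le (div_nonneg P.U_pos.le (by unfold cLp'; have := mR_pos P; have := P.S₀_pos; have := P.hV j; positivity))
  have hS := P.S₀_pos; have hV := P.hV j; have hm := mR_pos P
  unfold cLp' at *
  rw [le_div_iff₀ (by positivity)] at hL
  rw [le_div_iff₀ (by positivity)]
  rw [P.U_eq] at hL
  have key : ((P.S₀p : ℝ) * (P.Lp j * P.Vs j) * (2 * 2 ^ 12 * mRp d)) * 2 ^ (d + 1) ≤ P.𝔘p * 2 ^ (d + 1) := by
    calc ((P.S₀p : ℝ) * (P.Lp j * P.Vs j) * (2 * 2 ^ 12 * mRp d)) * 2 ^ (d + 1)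
        = P.Lp j * (2 ^ 12 * mRp d * 2 ^ (d + 2) * P.S₀p * P.Vs j) := by rw [pow_succ]; ring
      _ ≤ 2 ^ (d + 1) * P.𝔘p := hL
      _ = P.𝔘p * 2 ^ (d + 1) := by ring
  exact le_of_mul_le_mul_right key (by positivity)

/-- `S₀ L_θ V_θ ≤ 𝔘/(2 c_L' m)`. [folklore] -/
theorem S₀LθVθ_le : (P.S₀p : ℝ) * (P.Lθp * P.Vel) ≤ P.𝔘p / (2 * cLp' * mRp d) := by
  have hL := P.Lθ_le
  have hS := P.S₀_pos; have hV := P.one_le_Vθ; have hm := mR_pos P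
  unfold cLp' at *
  rw [le_div_iff₀ (by positivity)] at hL
  rw [le_div_iff₀ (by positivity)]
  rw [P.U_eq] at hL
  have key : ((P.S₀p : ℝ) * (P.Lθp * P.Vel) * (2 * 2 ^ 12 * mRp d)) * 2 ^ (d + 1) ≤ P.𝔘p * 2 ^ (d + 1) := by
    calc ((P.S₀p : ℝ) * (P.Lθp * P.Vel) * (2 * 2 ^ 12 * mRp d)) * 2 ^ (d + 1)
        = P.Lθp * (2 ^ 12 * mRp d * 2 ^ (d + 2) * P.S₀p * P.Vel) := by rw [pow_succ]; ring
      _ ≤ 2 ^ (d + 1) * P.𝔘p := hL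
      _ = P.𝔘p * 2 ^ (d + 1) := by ring
  exact le_of_mul_le_mul_right key (by positivity)

/-- **`S₀ (∑ⱼ LⱼVⱼ + L_θ V_θ) ≤ 𝔘/(2 c_L')`** (`d + 1 = m` terms of size `𝔘/(2c_L' m)`).
[cite: Waldschmidt1980, (3.11) (p. 265)] -/
theorem S₀LV_le : (P.S₀p : ℝ) * ((∑ j, P.Lp j * P.Vs j) + P.Lθp * P.Vel) ≤ P.𝔘p / (2 * cLp') := by
  have h1 : ∀ j, (P.S₀p : ℝ) * (P.Lp j * P.Vs j) ≤ P.𝔘p / (2 * cLp' * mRp d) := P.S₀LV_le_one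
  have h2 := P.S₀LθVθ_le
  have hm := mR_pos P
  calc (P.S₀p : ℝ) * ((∑ j, P.Lp j * P.Vs j) + P.Lθp * P.Vel)
      = (∑ j, (P.S₀p : ℝ) * (P.Lp j * P.Vs j)) + P.S₀p * (P.Lθp * P.Vel) := by rw [mul_add, mul_sum]
    _ ≤ (∑ _j : Fin d, P.𝔘p / (2 * cLp' * mRp d)) + P.𝔘p / (2 * cLp' * mRp d) := add_le_add (sum_le_sum fun j _ => h1 j) h2
    _ = (d + 1) * (P.𝔘p / (2 * cLp' * mRp d)) := by rw [sum_const, card_univ, Fintype.card_fin]; simp; ring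
    _ = P.𝔘p / (2 * cLp') := by unfold mRp cLp'; field_simp

/-- `L_θ S₀ ≤ 𝔘/2¹⁴` (`V_θ ≥ 1`, `m ≥ 2`, `c_L' = 2¹²`). [folklore] -/
theorem LθS₀_le : (P.Lθp : ℝ) * P.S₀p ≤ P.𝔘p / 2 ^ 14 := by
  have h := P.S₀LθVθ_le
  have hV := P.one_le_Vθ; have hm := two_le_mR P; have hS := P.S₀_pos; have hU := P.𝔘_pos
  have hL : (0 : ℝ) ≤ P.Lθp := Nat.cast_nonneg _
  unfold cLp' at h
  rw [le_div_iff₀ (by positivity)] at h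
  rw [le_div_iff₀ (by positivity)]
  have h1 : (P.Lθp : ℝ) * P.S₀p * 1 ≤ P.Lθp * P.S₀p * P.Vel := mul_le_mul_of_nonneg_left hV (by positivity)
  have h2 : (P.Lθp : ℝ) * P.S₀p * (2 ^ 14) ≤ P.S₀p * (P.Lθp * P.Vel) * (2 * 2 ^ 12 * mRp d) := by
    calc (P.Lθp : ℝ) * P.S₀p * 2 ^ 14 = (P.Lθp * P.S₀p * 1) * (2 * 2 ^ 12 * 2) := by ring
      _ ≤ (P.Lθp * P.S₀p * P.Vel) * (2 * 2 ^ 12 * mRp d) := by gcongr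
      _ = P.S₀p * (P.Lθp * P.Vel) * (2 * 2 ^ 12 * mRp d) := by ring
  linarith

/-! ### The `Δ`-polynomials: `h`, `L_b` -/

/-- `W⋆/G < h` (as reals). [folklore] -/
theorem Wstar_div_G_lt_hpar : P.Wstarp / P.Gp < P.hparp := by
  unfold hparp; push_cast; exact Nat.lt_floor_add_one _

/-- `1 ≤ h`. [folklore] -/
theorem one_le_hpar : 1 ≤ P.hparp := Nat.le_add_left 1 _

/-- `0 < h` (real). [folklore] -/
theorem hpar_pos : (0 : ℝ) < P.hparp := by have := P.one_le_hpar; exact_mod_cast this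

/-- `h G ≤ W⋆ + G`. [folklore] -/
theorem hparG_le : (P.hparp : ℝ) * P.Gp ≤ P.Wstarp + P.Gp := by
  unfold hparp; push_cast
  have hG := P.G_pos
  have h1 : (⌊P.Wstarp / P.Gp⌋₊ : ℝ) ≤ P.Wstarp / P.Gp := Nat.floor_le (div_nonneg (by linarith [P.one_le_Wstar]) hG.le)
  have : (⌊P.Wstarp / P.Gp⌋₊ : ℝ) * P.Gp ≤ P.Wstarp := by rwa [le_div_iff₀ hG] at h1
  nlinarith

/-- `h ≤ 3 W⋆` (and so `h` is lower-order). [folklore] -/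
theorem hpar_le : (P.hparp : ℝ) ≤ 3 * P.Wstarp := by
  have h := P.hparG_le; have hG := P.one_le_G; have hGW := P.G_le_two_Wstar; have h0 := P.hpar_pos
  nlinarith

/-- `1 ≤ L_b`. [folklore] -/
theorem one_le_Lb : 1 ≤ P.Lbp := Nat.le_add_left 1 _

/-- `h L_b G ≤ 𝔘/c_L + h G`, i.e. **`h L_b G ≤ 𝔘/c_L + W⋆ + G`**. [folklore] -/
theorem hparLbG_le : (P.hparp : ℝ) * P.Lbp * P.Gp ≤ P.𝔘p / cLp + (P.Wstarp + P.Gp) := by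
  have hh := P.hpar_pos; have hG := P.G_pos; have hU := P.U_pos
  have hLb : (P.Lbp : ℝ) ≤ P.Up / (cLp * 2 ^ (d + 1) * P.Gp * P.hparp) + 1 := by
    unfold Lbp; push_cast
    have := Nat.floor_le (show 0 ≤ P.Up / (cLp * 2 ^ (d + 1) * P.Gp * P.hparp) by unfold cLp; positivity)
    linarith
  have e : P.Up / (cLp * 2 ^ (d + 1) * P.Gp * P.hparp) = P.𝔘p / cLp / (P.Gp * P.hparp) := by
    rw [P.U_eq]; unfold cLp; field_simp
  rw [e] at hLb
  have h2 := P.hparG_le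
  calc (P.hparp : ℝ) * P.Lbp * P.Gp ≤ P.hparp * (P.𝔘p / cLp / (P.Gp * P.hparp) + 1) * P.Gp := by gcongr
    _ = P.𝔘p / cLp + P.hparp * P.Gp := by field_simp
    _ ≤ P.𝔘p / cLp + (P.Wstarp + P.Gp) := by linarith

/-- `h L_b ≤ 𝔘/c_L + 3W⋆` (`G ≥ 1`). [folklore] -/
theorem hparLb_le : (P.hparp : ℝ) * P.Lbp ≤ P.𝔘p / cLp + 3 * P.Wstarp := by
  have h := P.hparLbG_le; have hG := P.one_le_G; have hGW := P.G_le_two_Wstar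
  have h0 : 0 ≤ (P.hparp : ℝ) * P.Lbp := by positivity
  have hU : 0 ≤ P.𝔘p / cLp := by unfold cLp; have := P.𝔘_pos; positivity
  nlinarith

/-! ### The largest evaluation point against `h`: `log((X+h)/h) ≤ 6G` -/

/-- The largest (scaled) evaluation point of the `Δ`-polynomials: `X = 66 · 2^{d+1} L_θ S₀`
(`|z| ≤ 65 · SK ≤ 65 · 2^{d+J} S₀` at scale `2^{J₀−J} ≤ 2^{J₀} ≤ 2L_θ`). [folklore] -/
def Xptp : ℝ := 66 * 2 ^ (d + 1) * P.Lθp * P.S₀p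

/-- `0 ≤ X`. [folklore] -/
theorem Xpt_nonneg : 0 ≤ P.Xptp := by unfold Xptp; positivity

/-- `X ≤ 33 U/(c_L' m V_θ)`. [folklore] -/
theorem Xpt_le : P.Xptp ≤ 33 * P.Up / (cLp' * mRp d * P.Vel) := by
  have hL := P.Lθ_le
  have hS := P.S₀_pos; have hV := P.one_le_Vθ; have hm := mR_pos P; have hU := P.U_pos
  unfold Xptp cLp' at *
  rw [le_div_iff₀ (by positivity)] at hL
  rw [le_div_iff₀ (by positivity)]
  have e : (2 : ℝ) ^ (d + 2) = 2 * 2 ^ (d + 1) := by rw [pow_succ]; ring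
  rw [e] at hL
  have h2 : (0 : ℝ) < 2 ^ (d + 1) := by positivity
  nlinarith [mul_le_mul_of_nonneg_left hL h2.le]

/-- `Aᵐ m^{2m+1} ≤ e^{3G}`: `35m + 3m log m ≤ 3m(17 log 2 + log m) ≤ 3G`. [folklore] -/
theorem A_pow_mul_le : Ap ^ (d + 1) * mRp d ^ (2 * d + 3) ≤ Real.exp (3 * P.Gp) := by
  have hm := two_le_mR P; have hm0 := mR_pos P; have hVf := P.hVmax1
  have hlogm : 0 ≤ Real.log (mRp d) := Real.log_nonneg (by linarith)
  have h2 : (2 : ℝ) ^ 50 ≤ Real.exp 35 := by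
    have := Real.exp_one_gt_d9
    have h3 : (2.7182818283 : ℝ) ^ 35 ≤ Real.exp 1 ^ 35 := by gcongr
    rw [← Real.exp_nat_mul] at h3
    norm_num at h3 ⊢
    linarith
  have f1 : Ap ^ (d + 1) ≤ Real.exp (35 * mRp d) := by
    unfold Ap
    calc ((2 : ℝ) ^ 50) ^ (d + 1) ≤ (Real.exp 35) ^ (d + 1) := by gcongr
      _ = Real.exp (35 * mRp d) := by rw [← Real.exp_nat_mul]; unfold mRp; push_cast; ring_nf
  have f2 : mRp d ^ (2 * d + 3) ≤ Real.exp (3 * mRp d * Real.log (mRp d)) := by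
    calc mRp d ^ (2 * d + 3) = Real.exp ((2 * d + 3 : ℕ) * Real.log (mRp d)) := by
          rw [Real.exp_nat_mul, Real.exp_log hm0]
      _ ≤ Real.exp (3 * mRp d * Real.log (mRp d)) := by
          apply Real.exp_le_exp.mpr
          have e : ((2 * d + 3 : ℕ) : ℝ) = 2 * mRp d + 1 := by unfold mRp; push_cast; ring
          rw [e]; nlinarith
  have hG : 35 * mRp d + 3 * mRp d * Real.log (mRp d) ≤ 3 * P.Gp := by
    unfold Gp
    have hlog : Real.log (2 ^ 17 * mRp d * P.Vmax) = 17 * Real.log 2 + Real.log (mRp d) + Real.log P.Vmax := by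
      rw [Real.log_mul (by positivity) (by linarith), Real.log_mul (by positivity) hm0.ne', Real.log_pow]; push_cast; ring
    rw [hlog]
    have hl2 := Real.log_two_gt_d9
    have hlVf : 0 ≤ Real.log P.Vmax := Real.log_nonneg hVf
    nlinarith
  calc Ap ^ (d + 1) * mRp d ^ (2 * d + 3) ≤ Real.exp (35 * mRp d) * Real.exp (3 * mRp d * Real.log (mRp d)) := by
        have : (0 : ℝ) ≤ Ap ^ (d + 1) := by unfold Ap; positivity
        gcongr
    _ = Real.exp (35 * mRp d + 3 * mRp d * Real.log (mRp d)) := by rw [← Real.exp_add]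
    _ ≤ Real.exp (3 * P.Gp) := Real.exp_le_exp.mpr hG

/-- `∏ Vⱼ ≤ e^{G}` (`d log V_f ≤ m log(2¹⁷ m V_f)`). [folklore] -/
theorem prodV_le_exp_G : (∏ j, P.Vs j) ≤ Real.exp P.Gp := by
  have hm := two_le_mR P; have hm0 := mR_pos P; have hVf := P.hVmax1
  have h1 : (∏ j, P.Vs j) ≤ P.Vmax ^ d := by
    calc (∏ j, P.Vs j) ≤ ∏ _j : Fin d, P.Vmax := prod_le_prod (fun j _ => le_trans zero_le_one (P.hV j)) fun j _ => P.hVmax j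
      _ = P.Vmax ^ d := by rw [prod_const, card_univ, Fintype.card_fin]
  refine h1.trans ?_
  have hVf0 : 0 < P.Vmax := by linarith
  rw [← Real.exp_log hVf0, ← Real.exp_nat_mul, Real.exp_le_exp]
  unfold Gp
  have hlv : Real.log P.Vmax ≤ Real.log (2 ^ 17 * mRp d * P.Vmax) := by
    apply Real.log_le_log hVf0
    have : (1 : ℝ) ≤ 2 ^ 17 * mRp d := by nlinarith
    nlinarith
  have hlv0 : 0 ≤ Real.log P.Vmax := Real.log_nonneg hVf
  have hd : (d : ℝ) ≤ mRp d := by unfold mRp; linarith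
  calc (d : ℝ) * Real.log P.Vmax ≤ mRp d * Real.log P.Vmax := mul_le_mul_of_nonneg_right hd hlv0
    _ ≤ mRp d * Real.log (2 ^ 17 * mRp d * P.Vmax) := mul_le_mul_of_nonneg_left hlv hm0.le

/-- `G² ≤ e^{G}` (`e^{G/2} ≥ 1 + G/2 + G²/8 ≥ G`). [folklore] -/
theorem G_sq_le_exp_G : P.Gp ^ 2 ≤ Real.exp P.Gp := by
  have hG := P.G_pos
  have h := Real.quadratic_le_exp_of_nonneg (show 0 ≤ P.Gp / 2 by positivity)
  have h1 : P.Gp ≤ Real.exp (P.Gp / 2) := by nlinarith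
  calc P.Gp ^ 2 ≤ Real.exp (P.Gp / 2) ^ 2 := pow_le_pow_left₀ hG.le h1 2
    _ = Real.exp P.Gp := by rw [← Real.exp_nat_mul]; ring_nf

end PadicW80Par

end Summit.ABC.StewartYu

end
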